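import Summits.BirchSwinnertonDyer.Rank1Residual.GaloisImage.HauptmodulDeltaUnitValuation
import HarnessLib

/-!
# The level-`9` Hauptmodul at `v₃(j) = 3k + 5 ≥ 8`, `j/3^{v₃(j)} ≡ ε − 3e₁ (mod 9)` is
# VALUATION-FORCED after the unit normalisation:
# `v((θ(θ³ − 24)²/(2·3^{k+2}(θ³ − 24 − 3^{k+2}e₁)))² − 1)⁹ = v(3)⁴`
# (cell `b2b-bsdres`, team n1011, seat p02 gen 6 — row T-b11-F4, file F4c-H19 'Hauptmodul route,
# curve-free core at v₃(j) ≡ 2 (mod 3), v₃(j) ≥ 8'; pure valuation algebra in `ℚ̄`)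

HONEST FRAMING (cell `b2b-bsdres`, run/shared/lean/b2b/bsd-rank1-residual/, verbatim in every
file): the goal of the cell is to DELETE the COMBINATION-SHAPED residual classes of the
Birch–Swinnerton-Dyer formula for ALL analytic-rank `≤ 1` elliptic curves over `ℚ` — "full BSD
formula for every rank `≤ 1` curve in class `C`" assembled STRICTLY from published theorems — so
that the rank-`≤ 1` remainder becomes exactly the CONSTRUCTION-SHAPED classes, which are TYPED
(missing-input `Prop`s), NOT attempted. This is not "finishing BSD". Team n1011 (N10 / N11):
research route; no claim beyond the stated classes; labels UNCHANGED; nothing is booked. Theorems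
only (no definition, no named fact).

## What this file proves

`v` the place of `ℚ̄` over `3`, `t = v(3)`, `q = 3^k`; `K = j/3^{3k+5}` (a `3`-adic unit),
`S = θ³ = 3(δ + 8)` the level-`3` Hauptmodul at a NON-canonical `3`-torsion group (`v(S) = t`), so
that `δ³(δ + 8) = 9q³K(δ − 1)` and `v(δ)³ = t^{3k+2}` (`HauptmodulDeltaUnitValuation`).

* `valuation_numerator_vtwo` (§1) — `k ≥ 1`, `ε, e₁ = ±1`, `v(K − (ε − 3e₁)) ≤ t²`:
  `v(εKδ³(δ − 1) − 8(δ − 3e₁q)³) = t^{k+2}·v(δ)²`.  After multiplying by `δ + 8` and using the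
  quartic, `M(δ + 8) = 72e₁qδ²(δ + 8) + (9q³εK² − 216q²)δ² + (9q³(−2εK² − 8K) − 1728q² +
  216e₁q³)δ + 9q³(εK² + 8K + 192e₁)` with `εK² + 8K + 192e₁ = 9(2ε + 18e₁) + D(10 − 6εe₁ + εD)`,
  `D = K − ε + 3e₁`; the first term dominates.
* **`valuation_hauptmodul_nine_invariant_vtwo_pow_nine`** (§2) — `k ≥ 1`, `ε, e₁ = ±1`,
  `9 ∣ num(j/3^{3k+5} − (ε − 3e₁))`, `j(S − 27) = S(S − 24)³`, `v(S) = t`, `θ³ = S` ⟹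
  **`v((θ(θ³ − 24)²/(2·3^{k+2}(θ³ − 24 − 3^{k+2}e₁)))² − 1)⁹ = t⁴`** — valuation exactly `4/9`.

MECHANISM: `Y = θδ/(6q)` has `Y³ = K(δ − 1)/8` EXACTLY (a unit `≡ K ≢ ±1 (mod 9)`); dividing by
the one-unit `1 − 3e₁q/δ` (`3q/δ` a uniformiser of the cubic field `ℚ₃(δ)`) kills the digits of
order `1`: `X = εY/(1 − 3e₁q/δ)` has `ord(X³ − 1) = 4/3 < 3/2`, so `ord(X − 1) = 4/9` (cube-root
lemma) and `z = X² − 1` is sign-free.  The residues `K mod 9 ∈ {7, 4, 5, 2}` correspond to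
`(ε, e₁) = (1,1), (1,−1), (−1,1), (−1,−1)`; `K ≡ ±1 (mod 9)` has `e = 3` (no invariant of a cyclic
`9`-group can work, kit j135556).  Assembly with the curve side in `HauptmodulNineTowerVTwo`
(55 census cells at `v₃(j) ∈ {8, 11, 14, 20, 23}`; EVIDENCE kit j135897, 55/55).  Nothing booked.

References: [Maier2006] Table 4 (N = 3, 9), §5.
-/

noncomputable section

set_option maxRecDepth 10000

open scoped Classical

namespace Summit.BirchSwinnertonDyer.Rank1Residual.GaloisImage

open Literature.NumberTheory.EllipticCurves Literature.NumberTheory.GaloisRepresentations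
  Rat.HeightOneSpectrum

/-! ### §1 The numerator at `v₃(j) = 3k + 5`, `k ≥ 1` -/

/-- **`v(εKδ³(δ − 1) − 8(δ − 3e₁q)³) = v(3)^{k+2}·v(δ)²`** (`q = 3^k`, `k ≥ 1`, `ε, e₁ = ±1`,
`v(K − (ε − 3e₁)) ≤ v(3)²`, `v(K) = v(δ + 8) = 1`, `δ³(δ + 8) = 9q³K(δ − 1)`,
`v(δ)³ = v(3)^{3k+2}`).  See the module docstring for the identity behind it. [folklore] -/
theorem valuation_numerator_vtwo {δ K ε e₁ : AlgebraicClosure ℚ} {k : ℕ} (hk : 1 ≤ k)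
    (hε : ε = 1 ∨ ε = -1) (he : e₁ = 1 ∨ e₁ = -1)
    (hKε : (placeOver 3).valuation (K - (ε - 3 * e₁)) ≤
      (placeOver 3).valuation (3 : AlgebraicClosure ℚ) ^ 2)
    (hK : (placeOver 3).valuation K = 1)
    (h8 : (placeOver 3).valuation (δ + 8) = 1)
    (hR : δ ^ 3 * (δ + 8) = 9 * ((3 : AlgebraicClosure ℚ) ^ k) ^ 3 * K * (δ - 1))
    (hδ : (placeOver 3).valuation δ ^ 3 = (placeOver 3).valuation (3 : AlgebraicClosure ℚ) ^ (3 * k + 2)) :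
    (placeOver 3).valuation (ε * K * δ ^ 3 * (δ - 1) -
        8 * (δ - 3 * e₁ * (3 : AlgebraicClosure ℚ) ^ k) ^ 3) =
      (placeOver 3).valuation (3 : AlgebraicClosure ℚ) ^ (k + 2) * (placeOver 3).valuation δ ^ 2 := by
  set v := (placeOver 3).valuation with hv
  set t := v (3 : AlgebraicClosure ℚ) with ht
  set s := v δ with hs
  set q : AlgebraicClosure ℚ := (3 : AlgebraicClosure ℚ) ^ k with hq
  have ht1 : t < 1 := valuation_three_lt_one
  have ht0 : t ≠ 0 := valuation_three_ne_zero
  have ht0' : 0 < t := zero_lt_iff.mpr ht0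
  have hvq : v q = t ^ k := by rw [hq, map_pow]
  have hsq : ε ^ 2 = 1 := by rcases hε with h | h <;> rw [h] <;> norm_num
  have hesq : e₁ ^ 2 = 1 := by rcases he with h | h <;> rw [h] <;> norm_num
  have hvε : v ε = 1 := by
    rcases hε with h | h
    · rw [h, map_one]
    · rw [h, Valuation.map_neg, map_one]
  have hve : v e₁ = 1 := by
    rcases he with h | h
    · rw [h, map_one]
    · rw [h, Valuation.map_neg, map_one]
  have hunit : ∀ n : ℤ, ¬ (3 : ℤ) ∣ n → v (n : AlgebraicClosure ℚ) = 1 := fun n hn ↦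
    valuation_intCast_eq_one_of_not_dvd hn
  have h8v : v (8 : AlgebraicClosure ℚ) = 1 := by simpa using hunit 8 (by decide)
  have h9 : v (9 : AlgebraicClosure ℚ) = t ^ 2 := by
    rw [show (9 : AlgebraicClosure ℚ) = 3 ^ 2 by norm_num, map_pow]
  have h72 : v (72 : AlgebraicClosure ℚ) = t ^ 2 := by
    rw [show (72 : AlgebraicClosure ℚ) = 8 * 3 ^ 2 by norm_num, map_mul, map_pow, h8v, one_mul]
  have h216 : v (216 : AlgebraicClosure ℚ) = t ^ 3 := by
    rw [show (216 : AlgebraicClosure ℚ) = 8 * 3 ^ 3 by norm_num, map_mul, map_pow, h8v, one_mul]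
  have h1728 : v (1728 : AlgebraicClosure ℚ) = t ^ 3 := by
    rw [show (1728 : AlgebraicClosure ℚ) = 64 * 3 ^ 3 by norm_num, map_mul, map_pow,
      show (64 : AlgebraicClosure ℚ) = ((64 : ℤ) : AlgebraicClosure ℚ) by norm_num, hunit 64 (by decide),
      one_mul]
  have h1 : v (δ - 1) = 1 := by
    have e : δ - 1 = (δ + 8) - 9 := by ring
    have h9' : v (9 : AlgebraicClosure ℚ) < v (δ + 8) := by
      rw [h8, h9]; exact pow_lt_one₀ zero_le ht1 two_ne_zero
    rw [e, valuation_sub_eq_of_lt h9', h8]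
  -- `s`: `s³ = t^{3k+2}`, so `t^{k+1} < s`, `s < 1`, `s ≠ 0`
  have hs0 : s ≠ 0 := by
    intro h0; rw [h0, zero_pow three_ne_zero] at hδ; exact pow_ne_zero _ ht0 hδ.symm
  have hs0' : 0 < s := zero_lt_iff.mpr hs0
  have htks : t ^ (k + 1) < s := by
    refine lt_of_pow_lt_pow_left₀ 3 zero_le ?_
    rw [hδ, ← pow_mul]
    exact (pow_lt_pow_iff_of_lt_one' ht0 ht1).mpr (by omega)
  have hs1 : s < 1 := by
    refine lt_of_pow_lt_pow_left₀ 3 zero_le ?_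
    rw [hδ, one_pow]
    exact pow_lt_one₀ zero_le ht1 (by omega)
  -- the identity
  set D := K - (ε - 3 * e₁) with hD
  have hid : (ε * K * δ ^ 3 * (δ - 1) - 8 * (δ - 3 * e₁ * q) ^ 3) * (δ + 8) =
      72 * e₁ * q * δ ^ 2 * (δ + 8) +
        ((9 * q ^ 3 * ε * K ^ 2 - 216 * q ^ 2) * δ ^ 2 +
          (9 * q ^ 3 * (-2 * ε * K ^ 2 - 8 * K) - 1728 * q ^ 2 + 216 * e₁ * q ^ 3) * δ +
          9 * q ^ 3 * (ε * K ^ 2 + 8 * K + 192 * e₁)) := by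
    rcases he with h | h <;> subst h <;> linear_combination (ε * K * (δ - 1) - 8) * hR
  -- the main term
  have hmain : v (72 * e₁ * q * δ ^ 2 * (δ + 8)) = t ^ (k + 2) * s ^ 2 := by
    simp only [map_mul, map_pow, h72, hve, hvq, h8, mul_one]
    rw [← pow_add, add_comm 2 k]
  -- bounds on the coefficients
  have hq2 : v (q ^ 2) = t ^ (2 * k) := by rw [map_pow, hvq, ← pow_mul, mul_comm]
  have hq3 : v (q ^ 3) = t ^ (3 * k) := by rw [map_pow, hvq, ← pow_mul, mul_comm]
  have hT : 0 < t ^ (k + 2) := pow_pos ht0' _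
  have hc2 : v (9 * q ^ 3 * ε * K ^ 2 - 216 * q ^ 2) ≤ t ^ (2 * k + 3) := by
    refine (Valuation.map_sub _ _ _).trans (max_le ?_ ?_)
    · rw [map_mul, map_mul, map_mul, h9, hq3, hvε, map_pow, hK, one_pow, mul_one, mul_one, ← pow_add]
      exact pow_le_pow_right_of_le_one' ht1.le (by omega)
    · rw [map_mul, h216, hq2, ← pow_add]
      exact pow_le_pow_right_of_le_one' ht1.le (by omega)
  have hc1 : v (9 * q ^ 3 * (-2 * ε * K ^ 2 - 8 * K) - 1728 * q ^ 2 + 216 * e₁ * q ^ 3) ≤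
      t ^ (2 * k + 3) := by
    refine (Valuation.map_add _ _ _).trans (max_le ((Valuation.map_sub _ _ _).trans (max_le ?_ ?_)) ?_)
    · rw [map_mul, map_mul, h9, hq3]
      have hin : v (-2 * ε * K ^ 2 - 8 * K) ≤ 1 := by
        refine (Valuation.map_sub _ _ _).trans (max_le ?_ ?_)
        · rw [map_mul, map_mul, Valuation.map_neg, map_pow, hK, hvε, one_pow, mul_one, mul_one]
          exact (le_of_eq (by simpa using hunit 2 (by decide)))
        · rw [map_mul, h8v, hK, mul_one]
      calc t ^ 2 * t ^ (3 * k) * v (-2 * ε * K ^ 2 - 8 * K) ≤ t ^ 2 * t ^ (3 * k) * 1 :=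
            mul_le_mul' le_rfl hin
        _ = t ^ (3 * k + 2) := by rw [mul_one, ← pow_add, add_comm]
        _ ≤ t ^ (2 * k + 3) := pow_le_pow_right_of_le_one' ht1.le (by omega)
    · rw [map_mul, h1728, hq2, ← pow_add]
      exact pow_le_pow_right_of_le_one' ht1.le (by omega)
    · rw [map_mul, map_mul, h216, hve, mul_one, hq3, ← pow_add]
      exact pow_le_pow_right_of_le_one' ht1.le (by omega)
  have hc0 : v (ε * K ^ 2 + 8 * K + 192 * e₁) ≤ t ^ 2 := by
    have e : ε * K ^ 2 + 8 * K + 192 * e₁ = 3 ^ 2 * (2 * ε + 18 * e₁) + D * (10 - 6 * ε * e₁ + ε * D) := by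
      rw [hD]; linear_combination (2 * K - ε) * hsq + (9 * ε) * hesq
    rw [e]
    have hD2 : v D ≤ t ^ 2 := hKε
    refine (Valuation.map_add _ _ _).trans (max_le ?_ ?_)
    · rw [map_mul, map_pow]
      calc t ^ 2 * v (2 * ε + 18 * e₁) ≤ t ^ 2 * 1 := by
            refine mul_le_mul' le_rfl ((Valuation.map_add _ _ _).trans (max_le ?_ ?_))
            · rw [map_mul, hvε, mul_one]; exact le_of_eq (by simpa using hunit 2 (by decide))
            · rw [map_mul, hve, mul_one, show (18 : AlgebraicClosure ℚ) = 2 * 3 ^ 2 by norm_num, map_mul,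
                map_pow, show v (2 : AlgebraicClosure ℚ) = 1 by simpa using hunit 2 (by decide), one_mul]
              exact pow_le_one₀ zero_le ht1.le
        _ = t ^ 2 := mul_one _
    · rw [map_mul]
      calc v D * v (10 - 6 * ε * e₁ + ε * D) ≤ t ^ 2 * 1 := by
            refine mul_le_mul' hD2 ((Valuation.map_add _ _ _).trans (max_le
              ((Valuation.map_sub _ _ _).trans (max_le ?_ ?_)) ?_))
            · rw [show (10 : AlgebraicClosure ℚ) = ((10 : ℤ) : AlgebraicClosure ℚ) by norm_num,
                hunit 10 (by decide)]
            · rw [map_mul, map_mul, hvε, hve, mul_one, mul_one, show (6 : AlgebraicClosure ℚ) = 2 * 3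
                by norm_num, map_mul, show v (2 : AlgebraicClosure ℚ) = 1 by simpa using hunit 2 (by decide),
                one_mul]; exact ht1.le
            · rw [map_mul, hvε, one_mul]; exact hD2.trans (pow_le_one₀ zero_le ht1.le)
        _ = t ^ 2 := mul_one _
  -- the three small terms
  have hr1 : v ((9 * q ^ 3 * ε * K ^ 2 - 216 * q ^ 2) * δ ^ 2) < t ^ (k + 2) * s ^ 2 := by
    rw [map_mul, map_pow]
    have hlt : t ^ (2 * k + 3) < t ^ (k + 2) := (pow_lt_pow_iff_of_lt_one' ht0 ht1).mpr (by omega)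
    calc v (9 * q ^ 3 * ε * K ^ 2 - 216 * q ^ 2) * s ^ 2 ≤ t ^ (2 * k + 3) * s ^ 2 :=
          mul_le_mul' hc2 le_rfl
      _ < t ^ (k + 2) * s ^ 2 := mul_lt_mul_of_pos_right hlt (pow_pos hs0' 2)
  have hr2 : v ((9 * q ^ 3 * (-2 * ε * K ^ 2 - 8 * K) - 1728 * q ^ 2 + 216 * e₁ * q ^ 3) * δ) <
      t ^ (k + 2) * s ^ 2 := by
    rw [map_mul]
    calc v (9 * q ^ 3 * (-2 * ε * K ^ 2 - 8 * K) - 1728 * q ^ 2 + 216 * e₁ * q ^ 3) * s ≤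
        t ^ (2 * k + 3) * s := mul_le_mul' hc1 le_rfl
      _ = t ^ (k + 2) * (t ^ (k + 1) * s) := by rw [← mul_assoc, ← pow_add]; congr 2; omega
      _ < t ^ (k + 2) * (s * s) := mul_lt_mul_of_pos_left (mul_lt_mul_of_pos_right htks hs0') hT
      _ = t ^ (k + 2) * s ^ 2 := by rw [pow_two]
  have hr3 : v (9 * q ^ 3 * (ε * K ^ 2 + 8 * K + 192 * e₁)) < t ^ (k + 2) * s ^ 2 := by
    rw [map_mul, map_mul, h9, hq3]
    have hsq2 : t ^ (2 * k + 2) < s ^ 2 := by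
      rw [show 2 * k + 2 = (k + 1) * 2 by ring, pow_mul]
      exact pow_lt_pow_left₀ htks zero_le two_ne_zero
    calc t ^ 2 * t ^ (3 * k) * v (ε * K ^ 2 + 8 * K + 192 * e₁) ≤ t ^ 2 * t ^ (3 * k) * t ^ 2 :=
          mul_le_mul' le_rfl hc0
      _ = t ^ (k + 2) * t ^ (2 * k + 2) := by rw [← pow_add, ← pow_add, ← pow_add]; congr 1; omega
      _ < t ^ (k + 2) * s ^ 2 := mul_lt_mul_of_pos_left hsq2 hT
  have hrest : v ((9 * q ^ 3 * ε * K ^ 2 - 216 * q ^ 2) * δ ^ 2 +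
      (9 * q ^ 3 * (-2 * ε * K ^ 2 - 8 * K) - 1728 * q ^ 2 + 216 * e₁ * q ^ 3) * δ +
      9 * q ^ 3 * (ε * K ^ 2 + 8 * K + 192 * e₁)) < t ^ (k + 2) * s ^ 2 := by
    refine lt_of_le_of_lt (Valuation.map_add _ _ _) (max_lt ?_ hr3)
    exact lt_of_le_of_lt (Valuation.map_add _ _ _) (max_lt hr1 hr2)
  have hsum := congrArg v hid
  rw [map_mul, h8, mul_one, Valuation.map_add_eq_of_lt_left _ (by rw [hmain]; exact hrest), hmain]
    at hsum
  exact hsum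

/-! ### §2 Assembly: the invariant has valuation `4/9` -/

/-- **The level-`9` Hauptmodul at `v₃(j) = 3k + 5 ≥ 8`, `j/3^{v₃(j)} ≡ ε − 3e₁ (mod 9)` is
valuation-forced after the unit normalisation.**  Let `k ≥ 1`, `ε, e₁ = ±1`, `j ∈ ℚ` with
`9 ∣ num(j/3^{3k+5} − (ε − 3e₁))`, and `S, θ ∈ ℚ̄` with `j(S − 27) = S(S − 24)³`, `v(S) = v(3)`,
`θ³ = S`.  Then **`v((θ(θ³ − 24)²/(2·3^{k+2}(θ³ − 24 − 3^{k+2}e₁)))² − 1)⁹ = v(3)⁴`** —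
`3`-adic valuation exactly `4/9`. [cite: Maier2006, Table 4 (N = 3, 9) and §5] -/
theorem valuation_hauptmodul_nine_invariant_vtwo_pow_nine {j : ℚ} {k : ℕ} (hk : 1 ≤ k) {ε e₁ : ℤ}
    (hε : ε = 1 ∨ ε = -1) (he : e₁ = 1 ∨ e₁ = -1)
    (hj0 : (9 : ℤ) ∣ (j / 3 ^ (3 * k + 5) - ((ε - 3 * e₁ : ℤ) : ℚ)).num)
    {S θ : AlgebraicClosure ℚ}
    (hS : algebraMap ℚ (AlgebraicClosure ℚ) j * (S - 27) = S * (S - 24) ^ 3)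
    (hvS : (placeOver 3).valuation S = (placeOver 3).valuation (3 : AlgebraicClosure ℚ))
    (hθ : θ ^ 3 = S) :
    (placeOver 3).valuation
        ((θ * (θ ^ 3 - 24) ^ 2 / (2 * 3 ^ (k + 2) * (θ ^ 3 - 24 - 3 ^ (k + 2) * e₁))) ^ 2 - 1) ^ 9 =
      (placeOver 3).valuation (3 : AlgebraicClosure ℚ) ^ 4 := by
  set v := (placeOver 3).valuation with hv
  set t := v (3 : AlgebraicClosure ℚ) with ht
  have ht1 : t < 1 := valuation_three_lt_one
  have ht0 : t ≠ 0 := valuation_three_ne_zero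
  have h3 : (3 : AlgebraicClosure ℚ) ≠ 0 := by norm_num
  have hc3 : ¬ (3 : ℤ) ∣ (ε - 3 * e₁) := by
    rcases hε with h | h <;> rcases he with h' | h' <;> rw [h, h'] <;> decide
  have hε' : (ε : AlgebraicClosure ℚ) = 1 ∨ (ε : AlgebraicClosure ℚ) = -1 := by
    rcases hε with h | h
    · left; rw [h]; norm_num
    · right; rw [h]; norm_num
  have he' : (e₁ : AlgebraicClosure ℚ) = 1 ∨ (e₁ : AlgebraicClosure ℚ) = -1 := by
    rcases he with h | h
    · left; rw [h]; norm_num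
    · right; rw [h]; norm_num
  have hε3' : (ε : AlgebraicClosure ℚ) ^ 3 = ε := by rcases hε' with h | h <;> rw [h] <;> norm_num
  have hve : v (e₁ : AlgebraicClosure ℚ) = 1 := by
    rcases he' with h | h
    · rw [h, map_one]
    · rw [h, Valuation.map_neg, map_one]
  -- `K = j/3^{3k+5} ≡ ε − 3e₁ (mod 9)`
  obtain ⟨hKε, hK, hjK⟩ := valuation_facts_of_nine_dvd_num_sub (V := 3 * k + 5) hc3 hj0
  set K := algebraMap ℚ (AlgebraicClosure ℚ) (j / 3 ^ (3 * k + 5)) with hKdef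
  simp only [Int.cast_sub, Int.cast_mul, Int.cast_ofNat] at hKε
  -- `S = 3(δ + 8)`, `q = 3^k`
  obtain ⟨δ, hSδ⟩ : ∃ δ : AlgebraicClosure ℚ, S = 3 * (δ + 8) := ⟨S / 3 - 8, by field_simp; ring⟩
  subst hSδ
  set q : AlgebraicClosure ℚ := (3 : AlgebraicClosure ℚ) ^ k with hq
  have hR0 := delta_quartic_of_hauptmodul_three (n := 3 * k + 2) hjK hS rfl
  have hR : δ ^ 3 * (δ + 8) = 9 * q ^ 3 * K * (δ - 1) := by
    rw [hR0, hq]; ring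
  have h8 : v (δ + 8) = 1 := by
    have e : t * v (δ + 8) = t * 1 := by rw [mul_one, ← map_mul]; exact hvS
    exact mul_left_cancel₀ ht0 e
  obtain ⟨h1, hδ3'⟩ := valuation_delta_of_quartic (n := 3 * k + 2) hK h8 hR0
  set s := v δ with hs
  have hδ3 : s ^ 3 = t ^ (3 * k + 2) := hδ3'
  have hs0 : s ≠ 0 := by
    intro h0; rw [h0, zero_pow three_ne_zero] at hδ3; exact pow_ne_zero _ ht0 hδ3.symm
  have hδ0 : δ ≠ 0 := (Valuation.ne_zero_iff _).mp hs0
  have hvq : v q = t ^ k := by rw [hq, map_pow]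
  have hq0 : q ≠ 0 := pow_ne_zero _ h3
  have htks : t ^ (k + 1) < s := by
    refine lt_of_pow_lt_pow_left₀ 3 zero_le ?_
    rw [hδ3, ← pow_mul]
    exact (pow_lt_pow_iff_of_lt_one' ht0 ht1).mpr (by omega)
  -- `v(δ − 3e₁q) = s`
  have hdq : v (δ - 3 * e₁ * q) = s := by
    refine valuation_sub_eq_of_lt ?_
    rw [map_mul, map_mul, hve, mul_one, hvq, ← ht, ← pow_succ']
    exact htks
  have hdq0 : δ - 3 * e₁ * q ≠ 0 := (Valuation.ne_zero_iff _).mp (by rw [hdq]; exact hs0)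
  -- `Y = θ(θ³ − 24)²/(2·3^{k+2}(θ³ − 24 − 3^{k+2}e₁)) = θδ²/(6q(δ − 3e₁q))`
  have hθδ : θ ^ 3 - 24 = 3 * δ := by rw [hθ]; ring
  have hden : θ ^ 3 - 24 - 3 ^ (k + 2) * (e₁ : AlgebraicClosure ℚ) = 3 * (δ - 3 * e₁ * q) := by
    rw [hθδ, hq]; ring
  have hq2 : ((3 : AlgebraicClosure ℚ) ^ (k + 2)) = 9 * q := by rw [hq]; ring
  set Y := θ * (θ ^ 3 - 24) ^ 2 / (2 * 3 ^ (k + 2) * (θ ^ 3 - 24 - 3 ^ (k + 2) * e₁)) with hYdef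
  have hY : Y * (6 * q * (δ - 3 * e₁ * q)) = θ * δ ^ 2 := by
    have hne : 2 * 3 ^ (k + 2) * (θ ^ 3 - 24 - 3 ^ (k + 2) * (e₁ : AlgebraicClosure ℚ)) ≠ 0 := by
      rw [hden, hq2]
      exact mul_ne_zero (mul_ne_zero two_ne_zero (mul_ne_zero (by norm_num) hq0)) (mul_ne_zero h3 hdq0)
    have e : Y * (2 * 3 ^ (k + 2) * (θ ^ 3 - 24 - 3 ^ (k + 2) * (e₁ : AlgebraicClosure ℚ))) =
        θ * (θ ^ 3 - 24) ^ 2 := div_mul_cancel₀ _ hne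
    rw [hden, hq2, hθδ] at e
    have e' : (9 : AlgebraicClosure ℚ) * (Y * (6 * q * (δ - 3 * e₁ * q)) - θ * δ ^ 2) = 0 := by
      linear_combination e
    exact sub_eq_zero.mp ((mul_eq_zero.mp e').resolve_left (by norm_num))
  -- `(X³ − 1)·216q³(δ − 3e₁q)³ = 27q³·M`
  have hX3 : (((ε : AlgebraicClosure ℚ) * Y) ^ 3 - 1) * (216 * q ^ 3 * (δ - 3 * e₁ * q) ^ 3) =
      27 * q ^ 3 * (ε * K * δ ^ 3 * (δ - 1) - 8 * (δ - 3 * e₁ * q) ^ 3) := by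
    linear_combination ((ε : AlgebraicClosure ℚ) ^ 3 *
        ((Y * (6 * q * (δ - 3 * e₁ * q))) ^ 2 + Y * (6 * q * (δ - 3 * e₁ * q)) * (θ * δ ^ 2) +
          θ ^ 2 * δ ^ 4)) * hY +
      ((ε : AlgebraicClosure ℚ) ^ 3 * δ ^ 6) * hθ + (3 * (ε : AlgebraicClosure ℚ) ^ 3 * δ ^ 3) * hR +
      (27 * q ^ 3 * K * δ ^ 3 * (δ - 1)) * hε3'
  have hN := valuation_numerator_vtwo hk hε' he' hKε hK h8 hR hδ3'
  have h216 : v (216 : AlgebraicClosure ℚ) = t ^ 3 := by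
    rw [show (216 : AlgebraicClosure ℚ) = 8 * 3 ^ 3 by norm_num, map_mul, map_pow,
      show v (8 : AlgebraicClosure ℚ) = 1 by simpa using valuation_intCast_eq_one_of_not_dvd (n := 8) (by decide),
      one_mul]
  have h27 : v (27 : AlgebraicClosure ℚ) = t ^ 3 := by
    rw [show (27 : AlgebraicClosure ℚ) = 3 ^ 3 by norm_num, map_pow]
  have hq3 : v (q ^ 3) = t ^ (3 * k) := by rw [map_pow, hvq, ← pow_mul, mul_comm]
  have hval := congrArg v hX3
  rw [map_mul, map_mul, map_mul, h216, hq3, map_pow, hdq, map_mul, map_mul, h27, hq3, hN] at hval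
  change v (((ε : AlgebraicClosure ℚ) * Y) ^ 3 - 1) * (t ^ 3 * t ^ (3 * k) * s ^ 3) =
    t ^ 3 * t ^ (3 * k) * (t ^ (k + 2) * s ^ 2) at hval
  -- `A s³ = t^{k+2} s²`, hence `A s = t^{k+2}` and `A³ t^{3k+2} = t^{3k+6}`
  set A := v (((ε : AlgebraicClosure ℚ) * Y) ^ 3 - 1) with hA
  have hA1 : A * s = t ^ (k + 2) := by
    have e : A * s * (t ^ 3 * t ^ (3 * k) * s ^ 2) = t ^ (k + 2) * (t ^ 3 * t ^ (3 * k) * s ^ 2) := by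
      calc A * s * (t ^ 3 * t ^ (3 * k) * s ^ 2) = A * (t ^ 3 * t ^ (3 * k) * s ^ 3) := by
            rw [pow_succ' s 2, mul_assoc A s, ← mul_assoc s, mul_comm s (t ^ 3 * t ^ (3 * k)), mul_assoc]
        _ = t ^ 3 * t ^ (3 * k) * (t ^ (k + 2) * s ^ 2) := hval
        _ = t ^ (k + 2) * (t ^ 3 * t ^ (3 * k) * s ^ 2) := by
            rw [mul_comm (t ^ 3 * t ^ (3 * k)) (t ^ (k + 2) * s ^ 2), mul_assoc (t ^ (k + 2)),
              mul_comm (s ^ 2)]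
    exact mul_right_cancel₀ (mul_ne_zero (mul_ne_zero (pow_ne_zero _ ht0) (pow_ne_zero _ ht0))
      (pow_ne_zero _ hs0)) e
  have hcube : A ^ 3 = t ^ 4 := by
    have e : A ^ 3 * t ^ (3 * k + 2) = t ^ 4 * t ^ (3 * k + 2) := by
      calc A ^ 3 * t ^ (3 * k + 2) = (A * s) ^ 3 := by rw [mul_pow, hδ3]
        _ = (t ^ (k + 2)) ^ 3 := by rw [hA1]
        _ = t ^ 4 * t ^ (3 * k + 2) := by rw [← pow_mul, ← pow_add]; congr 1; omega
    exact mul_right_cancel₀ (pow_ne_zero _ ht0) e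
  exact valuation_sq_sub_one_pow_nine_of_cube_pow_four hε' hcube

end Summit.BirchSwinnertonDyer.Rank1Residual.GaloisImage
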